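import Mathlib
import HarnessLib
import Summits.Langlands.Langlands.Statement
import Summits.Langlands.Langlands.Theorems.IrreducibilityBySelfDualityReciprocityUpToIrreducibilityRankTwoConverseAway
import Literature.NumberTheory.Automorphic.CarayolUnramifiedOfLocalGlobalProofs
import Literature.NumberTheory.GaloisRepresentations.WeilDeligneOfGaloisUnramifiedProofs

/-!
# Crux `QuarterDeficit1951.CorrespondentFingerprint` (item stmt-Langlands-15898), line `Sketch`:
# stub `stub_satakeSmallPrimes` — Satake–Frobenius compatibility at an unramified place `v ∤ ℓ`
# from local–global compatibility

Support file (closes nothing; registered stub `stub_satakeSmallPrimes` of the checked skeleton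
`Cruxes/CorrespondentFingerprint/Lines/Sketch.lean`).

For a cuspidal `π` on `GL₂(𝔸_K)`, a framed `ρ : Γ_K → GL₂(ℚ̄_ℓ)`, `ι : ℚ̄_ℓ ≃ ℂ`, ANY reciprocity
data `RD` and a finite place `v ∤ ℓ` at which `ρ` is unramified, the summit's local–global clause
`LocalGlobalCompatibleAt RD ι π ρ v` forces `π` to be unramified at `v`
(`isUnramifiedAt_of_localGlobalCompatibleAt_of_isUnramifiedAt`), hence — by the landed rank-two
converse `rankTwo_satakeFrobCompatibleAt_of_localGlobalCompatibleAt_away` — the Satake clause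
`SatakeFrobCompatibleAt ι π ρ v` (`stub_satakeSmallPrimes`, stated over `ℚ` with the finite-image
hypothesis of the crux, which is not used).

The chain for unramifiedness of `π` is the tree's
`Carayol1986_unramifiedCompatibility.unramified_of_localGlobal` (`CarayolUnramifiedOfLocalGlobalProofs`)
re-instantiated in the summit's `L`-normalisation (no half twist, no totally-real / regularity input):
(a) at a place where `ρ` is unramified, the Grothendieck–Deligne recipe, its transport along `ι` and
its Frobenius-semisimplification give `rec_v(π_v) = ⟦r'⟧` with `r'.N = 0`, `r'.ρ` unramified
(`FramedGaloisRep.exists_frobSemisimple_unramified_of_isUnramifiedAt`); (b) `π_v` is generic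
(`CuspidalAutomorphicRepData.exists_isGeneric_of_hasLocalComponentAt`), so clause `lFactor_pairs`
of the datum `RD.llc v` makes `L(s, π_v × 1)` the Euler factor of an unramified `N = 0` parameter,
of degree `2` (`hasRSLFactor_of_recGL_unramified`); (c) degree `2` ⇒ `π_v` spherical
(`exists_mem_fixedPoints_glInt_of_hasRSLFactor_natDegree_two`, Jacquet–Langlands); (d) a spherical
local component makes `π` unramified at `v`
(`AutomorphicRepData.isUnramifiedAt_of_hasLocalComponentAt_of_mem_fixedPoints`, Borel–Jacquet /
Flath).  No definitions; standard axioms; no named fact assumed.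
-/

set_option linter.dupNamespace false -- project-wide option; `Summit.Langlands.Langlands` is the mandated namespace

noncomputable section

open scoped MatrixGroups Matrix NumberField Classical Polynomial
open Literature.NumberTheory.Automorphic Literature.NumberTheory.GaloisRepresentations
  IsDedekindDomain NumberField
open Summit.Langlands

namespace Summit.Langlands.Langlands.Theorems.CorrespondentFingerprint

/-- **Local–global compatibility at a place `v ∤ ℓ` where `ρ` is unramified forces `π` to be
unramified at `v`** (rank two, every number field `K`, every reciprocity data `RD`).  Unpack the
clause (`π_v`, `r`, `rℂ = ι(r)`, `rℂ^{F-ss} ∈ rec_v(π_v)`); since `ρ` kills `I_{K_v}` the recipe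
returns `N = 0` and an unramified `r.ρ`, properties kept by transport and Frobenius-semisimplification,
so `rec_v(π_v) = ⟦r'⟧` with `r'` unramified, `N = 0`
(`FramedGaloisRep.exists_frobSemisimple_unramified_of_isUnramifiedAt`); `π_v` is generic, so by
`lFactor_pairs` the JPSS polynomial of `(π_v, 1)` has degree `2` (`hasRSLFactor_of_recGL_unramified`),
so `π_v` has a non-zero `GL₂(𝒪_v)`-fixed vector
(`exists_mem_fixedPoints_glInt_of_hasRSLFactor_natDegree_two`), so `π` is unramified at `v`
(`isUnramifiedAt_of_hasLocalComponentAt_of_mem_fixedPoints`).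
[cite: CarayolASENS1986, Thm. (A) (pp. 410–411)] [cite: HarrisTaylorAMS2001, Thm. A (ii), (v)]
[cite: TateCorvallis1979, (4.1.3)–(4.2.1)] -/
theorem isUnramifiedAt_of_localGlobalCompatibleAt_of_isUnramifiedAt
    {K : Type} [Field K] [NumberField K] {ℓ : ℕ} [Fact ℓ.Prime]
    {hcpt : isCompact_glFiniteIntegralLevel 2 K} (RD : ReciprocityData K) (ι : PadicAlgCl ℓ ≃+* ℂ)
    (π : CuspidalAutomorphicRepData 2 K hcpt) (ρ : FramedGaloisRep K (PadicAlgCl ℓ) 2)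
    (v : HeightOneSpectrum (𝓞 K)) (hv : ((ℓ : ℕ) : 𝓞 K) ∉ v.asIdeal) (hρ : ρ.IsUnramifiedAt v)
    (hLG : LocalGlobalCompatibleAt RD ι π.1 ρ v) : π.1.IsUnramifiedAt v := by
  classical
  obtain ⟨πv, rv, rℂ, hloc, hWD, -, hTr, hcl⟩ := hLG
  haveI := πv.isIrreducible
  -- (a) `rec_v(π_v) = ⟦r'⟧` with `r'.N = 0` and `r'.ρ` unramified
  obtain ⟨r', hr', hq, hN, hur'⟩ :=
    ρ.exists_frobSemisimple_unramified_of_isUnramifiedAt hρ _ (hWD hv) hTr hcl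
  -- (b) `π_v` is generic
  obtain ⟨ψ, hψ, hgen⟩ := π.exists_isGeneric_of_hasLocalComponentAt v πv.ρ πv.isSmooth hloc
  -- (c) `L(s, π_v × 1)` has degree `2`, so `π_v` is spherical
  haveI : CharZero (v.adicCompletion K) :=
    charZero_of_injective_algebraMap (algebraMap K (v.adicCompletion K)).injective
  obtain ⟨x, hx0, hxK⟩ := exists_mem_fixedPoints_glInt_of_hasRSLFactor_natDegree_two πv ψ hψ
    (fun ν _ _ _ => hasRSLFactor_of_recGL_unramified (RD.llc v) πv r' hr' hq.symm hN hur' ψ hψ hgen ν)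
  rw [glInt_adicCompletion_eq] at hxK
  -- (d) Borel–Jacquet dictionary
  exact π.1.isUnramifiedAt_of_hasLocalComponentAt_of_mem_fixedPoints v πv hloc hx0 hxK

/-- **Registered stub `stub_satakeSmallPrimes` of line `Sketch` (crux stmt-Langlands-15898).**  For a
cuspidal `π` of `GL₂(𝔸_ℚ)`, a finite-image `ρ : Γ_ℚ → GL₂(ℚ̄_ℓ)` and a place `v ∤ ℓ` at which `ρ`
is unramified, local–global compatibility at `v` (`LocalGlobalCompatibleAt`: `rec_v(π_v) =
ι WD(ρ|_{Γ_v})^{F-ss}` through the Grothendieck–Deligne recipe) implies Satake–Frobenius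
compatibility at `v` (`SatakeFrobCompatibleAt`): `π` is unramified at `v`
(`isUnramifiedAt_of_localGlobalCompatibleAt_of_isUnramifiedAt`; the finite-image hypothesis is not
needed) and the landed rank-two converse
`ReciprocityUpToIrreducibility.rankTwo_satakeFrobCompatibleAt_of_localGlobalCompatibleAt_away`
(Carayol's local deduction on the Satake parameter) concludes.
[cite: CarayolASENS1986, Thm. (A)] [cite: HarrisTaylorAMS2001, Thm. A (ii), (v)]
[cite: TateCorvallis1979, (4.2.1)] -/
theorem stub_satakeSmallPrimes : ∀ (RD : Summit.Langlands.ReciprocityData ℚ) (ℓ : ℕ) [Fact ℓ.Prime]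
    (ι : PadicAlgCl ℓ ≃+* ℂ) (hcpt : isCompact_glFiniteIntegralLevel 2 ℚ)
    (π : CuspidalAutomorphicRepData 2 ℚ hcpt) (ρ : FramedGaloisRep ℚ (PadicAlgCl ℓ) 2)
    (v : HeightOneSpectrum (𝓞 ℚ)),
    (Set.range ρ).Finite → ((ℓ : ℕ) : 𝓞 ℚ) ∉ v.asIdeal → ρ.IsUnramifiedAt v →
    Summit.Langlands.LocalGlobalCompatibleAt RD ι π.1 ρ v →
    Summit.Langlands.SatakeFrobCompatibleAt ι π.1 ρ v :=
  fun RD _ _ ι _ π ρ v _ hv hρ hLG =>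
    ReciprocityUpToIrreducibility.rankTwo_satakeFrobCompatibleAt_of_localGlobalCompatibleAt_away
      RD ι π ρ v hv (isUnramifiedAt_of_localGlobalCompatibleAt_of_isUnramifiedAt RD ι π ρ v hv hρ hLG)
      hLG

end Summit.Langlands.Langlands.Theorems.CorrespondentFingerprint

end
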